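import Summits.BirchSwinnertonDyer.BirchSwinnertonDyer.Theorems.SchneiderFreeAdditiveX3GordCellOfKYBranchOnly
import Summits.BirchSwinnertonDyer.BirchSwinnertonDyer.Theorems.AdditiveBranchIMCInputs
import HarnessLib

/-!
# Route `SchneiderFreeAdditiveX3Upper` (K1 wing) on the (G-ord, `e = 2`) cell, PER PAIR: the upper half from the Heegner TWIST'S
# LOWER HALF (rung K1's rank-zero Case-1 theorem, item 19363 CLOSED) in place of the twist-unit certificate (wing r2)

Cell `bsd-schneider-ideate`, seat `bsd-schneider-door-c5` (prover, generation 21; assembly layer; `--supports` 20364).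
PARTITION: board row B6 ∩ X3 ∩ sst-twist, `r = 1`, (G-ord, `e = 2`) half (2 560 of 7 101 pairs) of `Rank1Residual.partition`;
types-the-object-of nothing new; RE-KEYS the wing's r2 input at a pair from a certificate (twist-unit) to the PARTNER CELL's
rank-zero lower half (rung K1, route `AdditiveBranchIMC`); closes none of B6's cells (BSD NOT advanced).
bears_on: K1-wing (items 20364 `TwistUnitX3OffSliver` r2, 20365 r3) + K1-door (19177) + K1 (19363 `X3CaseOneRankZero`, CLOSED).

WHY.  The wing's glue descends the JOINT upper bound `ord_p #Ш(W₁) + ord_p #Ш(W₁^{d_K}) ≤ ord_p #Ш_an(W₁) + ord_p #Ш_an(W₁^{d_K})`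
(co-STEP L at a Heegner field) to `ord_p #Ш(W) ≤ ord_p #Ш_an(W)` by subtracting a LOWER bound for the rank-zero twist.  Wing r2
(`TwistUnitX3OffSliver`) supplies the trivial one — a twist whose `#Ш_an` is a `p`-adic UNIT — a per-pair certificate, class-wide
OPEN (Vatsal / Kriz–Li density); on the census it fails to exist at `|d| ≤ 8 000` for 8 of 7 101 pairs (one of them (G-ord):
450450cj1 @3, where every rank-0 twist found has `ord₃ #Ш_an = 2`).  The tree ALSO has the honest descent
`Upper.missingUpperBoundAt_of_jointUpper_of_lower` (joint upper + `MissingLowerBoundAt` of the twist), and the twist of a (G-ord,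
`e = 2`) X3 pair by a Heegner `d_K` is again a rank-ZERO (G-ord, `e = 2`) X3 pair (§1: `p` splits in `K`, so `E^{(d_K)} ≅ E`
over `ℚ_p`) — precisely the shape of rung K1's CLOSED support item `X3CaseOneRankZero` (stmt-BirchSwinnertonDyer-19363, cell
`bsd-addord`): `K1.PrintedFacts → K1.ReadingFacts → ∀ W p, r_an = 0 → CellGordTwo W p → HasCaseOneMember W p → MissingLowerBoundAt W p`
(Greenberg–Vatsal Case 1: a member with a rational `p`-line ramified-even at `p`).  So at every (G-ord) pair the wing's r2 input can
be the PARTNER's lower half instead of a unit certificate, at the price of K1's two fact binders and the Case-1-member condition on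
the twist's isogeny class.
* §1 `subGordTwo_twist_of_heegner`, `cellGordTwo_twist_of_heegner` — (G-ord, `e = 2`) transports along a Heegner twist (door-c5
  gen 0's `subSemistableTwist_twist_of_heegner` proof, cell by cell).
* §2 `missingUpperBoundAt_gordTwo_of_partnerLower_of_hsieh_of_lzz_of_KY_branch_of_castellaHsieh_signed` — the UPPER half at a
  (G-ord) pair ⇐ door `PrintedFacts` ∧ Hsieh 2014 Thm A ∧ Liu–Zhang–Zhang 2018 ∧ Keller–Yin Thm 3.5.1 clause (iii) (PREPRINT) ∧
  Castella–Hsieh signed existence ∧ «the partner lower half» `hPL` (K1's 19363 shape, a HYPOTHESIS here) ∧ «every rank-0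
  Heegner twist of `W` has a Case-1 member» (per pair); `missingPPartAt_gordTwo_of_partnerLower_…`, `bsdp_gordTwo_of_partnerLower_…`
  with the door's per-pair lower half (`…GordCellOfKYBranchOnly` §2, clause (μ) added).
* §3 `…_of_K1facts_…` — `hPL` DISCHARGED BY NAME from rung K1's inputs (`AdditiveBranchIMCInputs.x3CaseOneRankZero_of_facts`,
  the proof term of item 19363): the (G-ord) pair's `MissingPPartAt` / `BSD(E,p)` ⇐ door `PrintedFacts` ∧ K1's eight printed +
  five reading facts ∧ Hsieh ∧ LZZ ∧ KY (iii)+(μ) ∧ CH-signed ∧ the Case-1-member condition on the rank-0 Heegner twists — NO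
  twist-unit certificate, NO open-problem crux.

HONEST FRAMING: THEOREMS ONLY; pure composition of tree theorems; CONDITIONAL on the displayed hypotheses (Keller–Yin is an
unrefereed PREPRINT; K1's `ReadingFacts` are readings at an additive prime; the Case-1-member condition is a per-class structural
hypothesis which FAILS on some classes — e.g. twists of `11a1 ⊗ χ_{p*}` at `p = 5` — so this road COMPLEMENTS wing r2, it does not
replace it); nothing is closed by me; BSD is proved for no curve; «closes rung: none».
References: [GreenbergVatsal2000] Invent. Math. 142 (2000) §2 p. 28, Thm. 3.12; [MilneADT2006] Thm. I.7.3 (Cassels);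
[GrossZagier1986] I.(6.3), (7.3); [JetchevSkinnerWan2017] §7.4.1; [Miller2011LMS] Def. 1.1; [SilvermanAEC2009] X.5 Cor. 5.4,
VII.1 Prop. 1.3(b); [KellerYin2024b] Thm. 3.5.1 (preprint); [FriedbergHoffstein1995] Thm. B.
-/

set_option autoImplicit false
-- `Summit.<P>.<Sub>` repeats `BirchSwinnertonDyer` by the tree's layout convention (D-0017)
set_option linter.dupNamespace false

noncomputable section

open scoped Classical NumberField

open Field NumberField IsDedekindDomain WeierstrassCurve
  Literature.NumberTheory.EllipticCurves Literature.NumberTheory.EllipticCurves.GreenbergSelmer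
  Literature.NumberTheory.GaloisRepresentations Literature.NumberTheory.GaloisCohomology
  Literature.NumberTheory.EllipticCurves.ModularForms Literature.NumberTheory.EllipticCurves.Rank1Residual
  Literature.NumberTheory.EllipticCurves.Rank1Residual.Typed
  Literature.NumberTheory.EllipticCurves.KellerYin2024 Literature.NumberTheory.EllipticCurves.GreenbergVatsal2000
  Summit.BirchSwinnertonDyer.Rank1Residual Summit.BirchSwinnertonDyer.Rank1Residual.Additive
  Summit.BirchSwinnertonDyer.Rank1Residual.X11b
  Summit.BirchSwinnertonDyer.BirchSwinnertonDyer.Theorems.SchneiderFree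
  Summit.BirchSwinnertonDyer.BirchSwinnertonDyer.Theorems.SchneiderFree.Upper
  Summit.BirchSwinnertonDyer.BirchSwinnertonDyer.Theses.SchneiderFreeAdditiveX3
  Summit.BirchSwinnertonDyer.BirchSwinnertonDyer.Theorems.SchneiderFreeAdditiveX3.ControlDischarged

namespace Summit.BirchSwinnertonDyer.BirchSwinnertonDyer.Theorems.SchneiderFreeAdditiveX3.KYBranchOnly

/-! ### §1 The (G-ord, `e = 2`) cell transports along a Heegner twist -/

section Transport

variable (p : ℕ) [hp : Fact p.Prime]

/-- **(G-ord, `e = 2`) transports along the Heegner twist**: for a pair `(E, p)`, `p` odd and additive for `E`, an imaginary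
quadratic `K` with odd `d_K` satisfying the Heegner hypothesis for `N_E` (so `p ∣ N_E` splits: `d_K ∈ (ℚ_p^×)²`, `p ∤ d_K`) and a
globally minimal model `Wd` of `E^{(d_K)}`: `SubGordTwo W p → SubGordTwo Wd p` — `j`, `ord_p Δ_min` and `f_p` agree (door-c5 gen 0's
`subSemistableTwist_twist_of_heegner` read on one cell). [cite: SilvermanAEC2009, X.5 Cor. 5.4 and VII.1 Prop. 1.3(b)] -/
theorem subGordTwo_twist_of_heegner (W : WeierstrassCurve ℚ) [W.IsElliptic] [W.IsGloballyMinimal] (hp2 : p ≠ 2) (K : Type)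
    [Field K] [NumberField K] (hK : IsImaginaryQuadratic K) (hodd : Odd (NumberField.discr K))
    (hHN : SatisfiesHeegnerHypothesis (W.conductorNorm ℤ) K) (hadd : Addv W p) {Wd : WeierstrassCurve ℚ} [Wd.IsElliptic]
    [Wd.IsGloballyMinimal] (Cd : VariableChange ℚ) (hWd : Cd • W.quadraticTwist (NumberField.discr K : ℚ) = Wd)
    (hS : SubGordTwo W p) : SubGordTwo Wd p := by
  have hD0 : (NumberField.discr K : ℚ) ≠ 0 := by exact_mod_cast NumberField.discr_ne_zero K
  have hpN : p ∣ W.conductorNorm ℤ := (W.dvd_conductorNorm_iff_not_hasGoodReductionAtPrime p).mpr hadd.1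
  have hsq : IsSquare (algebraMap ℚ ℚ_[p] (NumberField.discr K : ℚ)) := X11b.isSquare_discr_padic_of_heegner K hK hHN p hpN
  have hpd : ¬ (p : ℤ) ∣ NumberField.discr K :=
    not_dvd_discr_of_split hK hp.out hp2 (SatisfiesHeegnerHypothesis.of_dvd hpN hHN)
  have hj : Wd.j = W.j := AdditivePotMult.j_of_model_twist hD0 ⟨Cd, hWd⟩
  have hΔ : padicValInt p Wd.minimalDiscriminantInt = padicValInt p W.minimalDiscriminantInt :=
    X11b.padicValInt_minimalDiscriminantInt_twist_eq W p hD0 hsq Cd hWd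
  have hf : Additive.condExp Wd p = Additive.condExp W p := SchneiderFree.condExp_twist_of_heegner_eq p W K hK hodd hpd Cd hWd
  unfold Additive.SubGordTwo Additive.SubGord Additive.PotMult Additive.CondExpTwo Additive.semistabilityIndex at hS ⊢
  rw [hj, hΔ, hf]
  exact hS

/-- **The N10 cell (G-ord, `e = 2`) of the twist**: `ClassX3` and `SubGordTwo` transport (`classX3_twist_of_heegner`, §1), so the
minimal model of the Heegner twist lies in `N10.CellGordTwo` at `p` (the cell binder of rung K1's item 19363).
[cite: SilvermanAEC2009, X.5 Cor. 5.4 and VII.1 Prop. 1.3(b)] -/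
theorem cellGordTwo_twist_of_heegner (W : WeierstrassCurve ℚ) [W.IsElliptic] [W.IsGloballyMinimal] (hp2 : p ≠ 2) (K : Type)
    [Field K] [NumberField K] (hK : IsImaginaryQuadratic K) (hodd : Odd (NumberField.discr K))
    (hHN : SatisfiesHeegnerHypothesis (W.conductorNorm ℤ) K) (hX : ClassX3 W p) {Wd : WeierstrassCurve ℚ} [Wd.IsElliptic]
    [Wd.IsGloballyMinimal] (Cd : VariableChange ℚ) (hWd : Cd • W.quadraticTwist (NumberField.discr K : ℚ) = Wd)
    (hS : SubGordTwo W p) : N10.CellGordTwo Wd p := by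
  have hXd : ClassX3 Wd p := SchneiderFree.classX3_twist_of_heegner p W K hK hHN hX Cd hWd
  have hGd : SubGordTwo Wd p := subGordTwo_twist_of_heegner p W hp2 K hK hodd hHN hX.2 Cd hWd hS
  exact ⟨hp2, hXd.2, (classX3Gord_of_subGordTwo_of_odd Wd p hp2 hXd hGd).2, hGd.2⟩

end Transport

/-! ### §2 The UPPER half per pair on the (G-ord, `e = 2`) cell from the partner's LOWER half -/

/-- **UPPER half per pair on the (G-ord, `e = 2`) cell from the PARTNER's LOWER half — no twist-unit certificate.**  Inputs: door
`PrintedFacts` ∧ Hsieh 2014 Thm. A ∧ Liu–Zhang–Zhang 2018 ∧ Keller–Yin Thm. 3.5.1 clause (iii) (PREPRINT) ∧ Castella–Hsieh signed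
existence (these give the wing's co-socket, gen 20), the HYPOTHESIS SHAPE `hPL` «rank-0 (G-ord, `e = 2`) curves with a Case-1 member
satisfy the lower half» (= the conclusion of rung K1's CLOSED item `X3CaseOneRankZero`, discharged in §3), and per pair «every
rank-0 globally minimal Heegner twist of `W` has a Case-1 member».  Proof: the Heegner/twist datum with `d_K ≡ 1 (mod 8)`
(Friedberg–Hoffstein; `d_K ≠ −3`, `p ∤ d_K`), the co-chain member `W₁ ∼ W` at `K` (`Upper.coChainMemberField_gordTwo_…` fed gen 20's
wing crux by name and the CLOSED control corner), its Heegner point, co-STEP L, the JOINT upper bound at `(W₁, W₁^{d_K})`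
(`jointUpperBoundAt_of_coStepL_manin`), transport to `(W, Wd)` (`jointUpperBoundAt_of_isIsogenous`, Cassels), then
`Upper.missingUpperBoundAt_of_jointUpper_of_lower` with `hPL` at `Wd` (rank 0; `CellGordTwo Wd p` by §1).  CONDITIONAL on the
displayed hypotheses; closes no item; BSD not advanced. [cite: GrossZagier1986, Thm. I.(6.3) and (7.3)] [cite: MilneADT2006, Thm. I.7.3]
[cite: JetchevSkinnerWan2017, §7.4.1 (arXiv:1512.06894 p. 30)] [cite: FriedbergHoffstein1995, Thm. B]
[cite: KellerYin2024b, Thm. 3.5.1 (arXiv:2410.23241 p. 20) (preprint; hypotheses)] -/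
theorem missingUpperBoundAt_gordTwo_of_partnerLower_of_hsieh_of_lzz_of_KY_branch_of_castellaHsieh_signed (hF : PrintedFacts)
    (hA : Hsieh2014.thmA_exists_isHsiehLFunction_unrPeriod_anyLevel)
    (hL : LiuZhangZhang2018.thm151_thm153_modularCurve_heegnerVector_additive)
    (hKYb : thm351_charIdeal_eq_branch_OPEN) (hCHσ : castellaHsieh2018_exists_isBranchBDPLFunction_signed)
    (hPL : ∀ (Wd : WeierstrassCurve ℚ) [Wd.IsElliptic] [Wd.IsGloballyMinimal] (p : ℕ) [Fact p.Prime],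
      Wd.analyticRank = 0 → N10.CellGordTwo Wd p → HasCaseOneMember Wd p → MissingLowerBoundAt Wd p) :
    ∀ (W : WeierstrassCurve ℚ) [W.IsElliptic] [W.IsGloballyMinimal] (p : ℕ) [Fact p.Prime],
      W.analyticRank = 1 → p ≠ 2 → ClassX3 W p → Additive.SubGordTwo W p →
      (∀ (d : ℤ) (Wd : WeierstrassCurve ℚ) [Wd.IsElliptic] [Wd.IsGloballyMinimal],
        (∃ C : VariableChange ℚ, C • W.quadraticTwist (d : ℚ) = Wd) → Wd.analyticRank = 0 → HasCaseOneMember Wd p) →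
      MissingUpperBoundAt W p := by
  obtain ⟨hGZ, hKo, hGZK, hmod, hPar, hCas, hGZ73, hFH, hpar, hHP, -, -, -⟩ := id hF
  have hCtl := anticycControlAdditiveKF_proof controlFacts_proof.1 controlFacts_proof.2.1 controlFacts_proof.2.2.1
    controlFacts_proof.2.2.2 hKo
  have hCoG := gordTwoBranchCoIMCField_of_hsieh_of_lzz_of_KY_branch_of_castellaHsieh_signed hKo hPar hA hL hKYb hCHσ
  intro W _ _ p _ hr hp2 hX hG hC1
  have hpp : p.Prime := Fact.out
  have hS : Additive.SubSemistableTwist W p := Or.inr hG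
  -- the Heegner/twist datum with `d_K ≡ 1 (mod 8)` (off the sliver, `p ∤ d_K`, `p ∤ #𝓞_K^×`)
  obtain ⟨N, _, K, _, _, Dt, H, ι, P, Wd, _, _, hN, hK, hodd, hunit, hHe, hLtw, hP, hnt, hWd, hrd, hXd, hSd, h8⟩ :=
    exists_heegnerTwistDataManin_discr_emod_eight hFH hpar hHP hGZ hmod W p hr hp2 hX hS
  obtain ⟨Cd, hCd⟩ := hWd
  have hdK : NumberField.discr K ≠ -3 := discr_ne_neg_three_of_emod_eight h8
  have hD0 : (NumberField.discr K : ℚ) ≠ 0 := by exact_mod_cast NumberField.discr_ne_zero K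
  have hpN : p ∣ W.conductorNorm ℤ := (W.dvd_conductorNorm_iff_not_hasGoodReductionAtPrime p).mpr hX.2.1
  have hHH : SatisfiesHeegnerHypothesis (W.conductorNorm ℤ) K := by rw [hN]; exact hHe
  obtain ⟨hpd, hw⟩ := X11b.Three.not_dvd_discr_and_not_dvd_torsionOrder_of_heegner hK hHH hp2 hpN
  -- the co-chain member `W₁ ∼ W` at `K`
  obtain ⟨W₁, _, _, h1, hN1, hLoc1, htf1, hco1⟩ :=
    Upper.coChainMemberField_gordTwo_of_coIMCField_of_control hKo hPar hCtl hCoG W p hr hp2 hX hG K hK hpd hdK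
  haveI := W.isElliptic_quadraticTwist hD0
  haveI := W₁.isElliptic_quadraticTwist hD0
  have hr1 : W₁.analyticRank = 1 := by rw [← analyticRank_eq_of_isIsogenous' h1]; exact hr
  have hHH1 : SatisfiesHeegnerHypothesis (W₁.conductorNorm ℤ) K := by rw [hN1]; exact hHH
  have hpN1 : p ∣ W₁.conductorNorm ℤ := by rw [hN1]; exact hpN
  have hLd1 : (W₁.quadraticTwist (NumberField.discr K : ℚ)).entireLFunction 1 ≠ 0 := by
    rw [← entireLFunction_eq_of_isIsogenous' (h1.quadraticTwist hD0)]; exact hLtw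
  -- its Heegner point, co-STEP L at `K`, and the JOINT upper half at `(W₁, W₁d)`
  haveI hN0 : NeZero (W₁.conductorNorm ℤ) := ⟨W₁.conductorNorm_pos_holds.ne'⟩
  obtain ⟨Dt₁, H₁, ι₁, P₁, hP₁, hnt₁⟩ :=
    exists_heegnerPoint_not_isOfFinAddOrder_of_twist_ne_zero hHP hGZ hmod W₁ (W₁.conductorNorm ℤ) K hr1 rfl hK hHH1 hLd1
  have hI : IndexUpperBoundLeAt W₁ p K P₁ (padicValNat p Dt₁.c.natAbs) :=
    hco1 (W₁.conductorNorm ℤ) Dt₁ H₁ ι₁ P₁ hr1 hLoc1 rfl hK hodd hw hHH1 hLd1 hP₁ hnt₁ htf1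
  obtain ⟨C₁, hC₁⟩ := hasGlobalMinimalModel_rat_holds (W₁.quadraticTwist (NumberField.discr K : ℚ))
  set W₁d : WeierstrassCurve ℚ := C₁ • W₁.quadraticTwist (NumberField.discr K : ℚ) with hW₁d_def
  haveI : W₁d.IsGloballyMinimal := hC₁
  have hW₁d : C₁ • W₁.quadraticTwist (NumberField.discr K : ℚ) = W₁d := rfl
  have hJ1 : JointUpperBoundAt W₁ W₁d p :=
    jointUpperBoundAt_of_coStepL_manin hGZ hKo hGZK hmod hGZ73 W₁ p (W₁.conductorNorm ℤ) K Dt₁ H₁ ι₁ P₁ W₁d hr1 rfl hpN1 hK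
      hodd hw hHH1 hLd1 hP₁ ⟨C₁, hW₁d⟩ hp2 hI
  -- transport the joint bound to `(W, Wd)` along the isogenies `W₁ ∼ W`, `W₁d ∼ Wd`
  have h1W : IsIsogenous W₁ W := h1.symm_of_isElliptic
  have h1d : IsIsogenous W₁d Wd := by
    rw [← hW₁d, ← hCd]
    exact IsIsogenous.trans' (IsIsogenous.trans' (isIsogenous_of_smul _ C₁) (h1W.quadraticTwist hD0)) (isIsogenous_smul _ Cd)
  have hrd1 : W₁d.analyticRank ≤ 1 := by
    have h0 : (W₁.quadraticTwist (NumberField.discr K : ℚ)).analyticRank = 0 :=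
      ((W₁.quadraticTwist _).analyticRank_eq_zero_iff_holds (hmod _)).2 hLd1
    rw [← hW₁d, analyticRank_smul, h0]; exact zero_le_one
  have hJ : JointUpperBoundAt W Wd p := jointUpperBoundAt_of_isIsogenous hCas hGZK hmod h1W h1d hr1.le hrd1 hJ1
  -- the partner's lower half at `Wd` (rank 0, cell (G-ord, e = 2), Case-1 member by hypothesis)
  have hcell : N10.CellGordTwo Wd p := cellGordTwo_twist_of_heegner p W hp2 K hK hodd hHH hX Cd hCd hG
  exact Upper.missingUpperBoundAt_of_jointUpper_of_lower hJ (hPL Wd p hrd hcell (hC1 _ Wd ⟨Cd, hCd⟩ hrd))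

/-- **BOTH halves per pair on the (G-ord, `e = 2`) cell from the partner's lower half**: the door's per-pair lower half
(`missingLowerBoundAt_gordTwo_…`, clause (μ) added) and §2. CONDITIONAL; closes no item; BSD not advanced.
[cite: Miller2011LMS, Def. 1.1] [cite: KellerYin2024b, Thm. 3.5.1 (arXiv:2410.23241 p. 20) (preprint; hypotheses)] -/
theorem missingPPartAt_gordTwo_of_partnerLower_of_hsieh_of_lzz_of_KY_branch_of_castellaHsieh_signed (hF : PrintedFacts)
    (hA : Hsieh2014.thmA_exists_isHsiehLFunction_unrPeriod_anyLevel)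
    (hL : LiuZhangZhang2018.thm151_thm153_modularCurve_heegnerVector_additive)
    (hKYb : thm351_charIdeal_eq_branch_OPEN) (hKYμ : thm351_mu_zero_branch_OPEN)
    (hCHσ : castellaHsieh2018_exists_isBranchBDPLFunction_signed)
    (hPL : ∀ (Wd : WeierstrassCurve ℚ) [Wd.IsElliptic] [Wd.IsGloballyMinimal] (p : ℕ) [Fact p.Prime],
      Wd.analyticRank = 0 → N10.CellGordTwo Wd p → HasCaseOneMember Wd p → MissingLowerBoundAt Wd p) :
    ∀ (W : WeierstrassCurve ℚ) [W.IsElliptic] [W.IsGloballyMinimal] (p : ℕ) [Fact p.Prime],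
      W.analyticRank = 1 → p ≠ 2 → ClassX3 W p → Additive.SubGordTwo W p →
      (∀ (d : ℤ) (Wd : WeierstrassCurve ℚ) [Wd.IsElliptic] [Wd.IsGloballyMinimal],
        (∃ C : VariableChange ℚ, C • W.quadraticTwist (d : ℚ) = Wd) → Wd.analyticRank = 0 → HasCaseOneMember Wd p) →
      MissingPPartAt W p :=
  fun W _ _ p _ hr hp2 hX hG hC1 =>
    missingPPartAt_of_lower_of_upper W p
      (missingLowerBoundAt_gordTwo_of_printedFacts_of_hsieh_of_lzz_of_KY_branch_of_castellaHsieh_signed hF hA hL hKYb hKYμ hCHσ W p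
        hr hp2 hX hG)
      (missingUpperBoundAt_gordTwo_of_partnerLower_of_hsieh_of_lzz_of_KY_branch_of_castellaHsieh_signed hF hA hL hKYb hCHσ hPL W p
        hr hp2 hX hG hC1)

/-! ### §3 The partner's lower half BY NAME from rung K1's inputs (item 19363 `X3CaseOneRankZero`, CLOSED) -/

/-- **`MissingPPartAt` per pair on the (G-ord, `e = 2`) cell with rung K1's rank-zero Case-1 theorem as the wing's r2 input** —
§2 with `hPL` := `AdditiveBranchIMCInputs.x3CaseOneRankZero_of_facts` (the proof term of K1's item 19363, cell `bsd-addord`; its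
thirteen binders are route `AdditiveBranchIMC`'s `PrintedFacts` (8) and `ReadingFacts` (5), displayed here by name).  INPUT
LEDGER at such a pair: door `PrintedFacts` ∧ K1's printed/reading facts ∧ Hsieh 2014 Thm A ∧ LZZ 2018 ∧ Keller–Yin Thm 3.5.1
clauses (iii)+(μ) (PREPRINT) ∧ CH signed existence ∧ «every rank-0 Heegner twist of `W` has a Case-1 member» — NO twist-unit
certificate, NO open-problem crux.  CONDITIONAL; closes no item; BSD not advanced.
[cite: GreenbergVatsal2000, Thm 3.12] [cite: Delbourgo1998, Prop 4] [cite: MilneADT2006, Thm I.7.3]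
[cite: KellerYin2024b, Thm. 3.5.1 (arXiv:2410.23241 p. 20) (preprint; hypotheses)] -/
theorem missingPPartAt_gordTwo_of_K1facts_of_hsieh_of_lzz_of_KY_branch_of_castellaHsieh_signed (hF : PrintedFacts)
    (hA : Hsieh2014.thmA_exists_isHsiehLFunction_unrPeriod_anyLevel)
    (hL : LiuZhangZhang2018.thm151_thm153_modularCurve_heegnerVector_additive)
    (hKYb : thm351_charIdeal_eq_branch_OPEN) (hKYμ : thm351_mu_zero_branch_OPEN)
    (hCHσ : castellaHsieh2018_exists_isBranchBDPLFunction_signed)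
    -- rung K1's `PrintedFacts` (route `AdditiveBranchIMC`)
    (h23 : datumSelmer_nonPrimitive_invariants)
    (h414 : Greenberg1999.prop414_noFiniteSubmodule_of_not_dvd_torsionOrder)
    (hGrK : Greenberg1999.imKummer_ge_strictCondition_goodOrdinary)
    (hDel98 : Delbourgo1998.prop4_rankZero_pow_dvd_constantCoeff)
    -- rung K1's `ReadingFacts`
    (hW16 : Wuthrich2014.thm16_halfEigenCharIdeal_dvd_cyclotomicPrime)
    (hGV : thm312_branch_unitContent_and_lambda_eq_residual_goodOrd)
    (hLiftF : residualEpsilon_surjOn_of_lineRamifiedEven) (hLiftE : residualEpsilon_surjOn_of_lineEven)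
    (hDelG : Delbourgo1998.prop4_rankZero_constantCoeff_eq_unit_mul_of_potGoodOrd) :
    ∀ (W : WeierstrassCurve ℚ) [W.IsElliptic] [W.IsGloballyMinimal] (p : ℕ) [Fact p.Prime],
      W.analyticRank = 1 → p ≠ 2 → ClassX3 W p → Additive.SubGordTwo W p →
      (∀ (d : ℤ) (Wd : WeierstrassCurve ℚ) [Wd.IsElliptic] [Wd.IsGloballyMinimal],
        (∃ C : VariableChange ℚ, C • W.quadraticTwist (d : ℚ) = Wd) → Wd.analyticRank = 0 → HasCaseOneMember Wd p) →
      MissingPPartAt W p := by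
  obtain ⟨-, -, hGZK, hmod, hmodD, hCas, -⟩ := id hF
  exact missingPPartAt_gordTwo_of_partnerLower_of_hsieh_of_lzz_of_KY_branch_of_castellaHsieh_signed hF hA hL hKYb hKYμ hCHσ
    (AdditiveBranchIMCInputs.x3CaseOneRankZero_of_facts h23 h414 hGrK hDel98 hGZK hmod hmodD hCas hW16 hGV hLiftF hLiftE hDelG)

/-- **Miller's `BSD(E, p)` per pair on the (G-ord, `e = 2`) cell with K1's Case-1 theorem as the wing's r2 input**
(`bsdp_of_missingPPartAt`; rank = analytic rank and `Ш` finite by GZK).  NOT a proof of BSD for any curve.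
[cite: Miller2011LMS, §1 and Def. 1.1] [cite: GreenbergVatsal2000, Thm 3.12] -/
theorem bsdp_gordTwo_of_K1facts_of_hsieh_of_lzz_of_KY_branch_of_castellaHsieh_signed (hF : PrintedFacts)
    (hA : Hsieh2014.thmA_exists_isHsiehLFunction_unrPeriod_anyLevel)
    (hL : LiuZhangZhang2018.thm151_thm153_modularCurve_heegnerVector_additive)
    (hKYb : thm351_charIdeal_eq_branch_OPEN) (hKYμ : thm351_mu_zero_branch_OPEN)
    (hCHσ : castellaHsieh2018_exists_isBranchBDPLFunction_signed)
    (h23 : datumSelmer_nonPrimitive_invariants)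
    (h414 : Greenberg1999.prop414_noFiniteSubmodule_of_not_dvd_torsionOrder)
    (hGrK : Greenberg1999.imKummer_ge_strictCondition_goodOrdinary)
    (hDel98 : Delbourgo1998.prop4_rankZero_pow_dvd_constantCoeff)
    (hW16 : Wuthrich2014.thm16_halfEigenCharIdeal_dvd_cyclotomicPrime)
    (hGV : thm312_branch_unitContent_and_lambda_eq_residual_goodOrd)
    (hLiftF : residualEpsilon_surjOn_of_lineRamifiedEven) (hLiftE : residualEpsilon_surjOn_of_lineEven)
    (hDelG : Delbourgo1998.prop4_rankZero_constantCoeff_eq_unit_mul_of_potGoodOrd) :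
    ∀ (W : WeierstrassCurve ℚ) [W.IsElliptic] [W.IsGloballyMinimal] (p : ℕ) [Fact p.Prime],
      W.analyticRank = 1 → p ≠ 2 → ClassX3 W p → Additive.SubGordTwo W p →
      (∀ (d : ℤ) (Wd : WeierstrassCurve ℚ) [Wd.IsElliptic] [Wd.IsGloballyMinimal],
        (∃ C : VariableChange ℚ, C • W.quadraticTwist (d : ℚ) = Wd) → Wd.analyticRank = 0 → HasCaseOneMember Wd p) →
      BSDp W p :=
  fun W _ _ p _ hr hp2 hX hG hC1 =>
    bsdp_of_missingPPartAt W p hF.2.2.1 (le_of_eq hr)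
      (missingPPartAt_gordTwo_of_K1facts_of_hsieh_of_lzz_of_KY_branch_of_castellaHsieh_signed hF hA hL hKYb hKYμ hCHσ h23 h414 hGrK
        hDel98 hW16 hGV hLiftF hLiftE hDelG W p hr hp2 hX hG hC1)

end Summit.BirchSwinnertonDyer.BirchSwinnertonDyer.Theorems.SchneiderFreeAdditiveX3.KYBranchOnly

end
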